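import Summits.KontsevichZagierPeriods.Zeta5Search.WedgeDictionaryCornerIdentity
import HarnessLib

/-!
# The wedge dictionary on the EDGE `b = (n; 1, 0⁶)`: a second infinite family (cell `pub-zeta5`, P1)

HONEST FRAMING: systematic search; no irrationality claim unless certified.

OUR work (Summit side), P1 seat generation 2. The edge `b' = (n;1,0⁶)` (= `bCorner' n`, the corner's partner) corresponds to
the cellular parameters `a = (n−1, 0, n, 0, n, n, n, n)`. Its own partner (index `2`, `b'' = (n;1,1,0⁵)`) has summand
`R''_n = (t+1)²(t+n+1)² R_n`, `R_n = (2t+n+2)/((t+1)_{n+1})⁶`. One more creative-telescoping certificate (found by the cell,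
`HOME/code/p1/corner/edge_certs.py`):

* `gosper_edge`: `[21n(3n+1)(t+1)²(t+n+1)² − n·A'(n)](2t+n+2)(t+n+2)⁶ − n·B'(n)(2t+n+3) = (t+1)⁶ỹ(t+1) − (t+n+2)⁶ỹ(t)` with
  `A' = n²(61n³+81n²+42n+8)`, `B' = 2n²(n+1)⁹`, `ỹ` of degree 6 in `t`; transferred (`edge_contiguity`):
  `21n(3n+1)·U''_n = n·A'(n)·U_n + n·B'(n)·U_{n+1}` and the same for `W`.

With `corner_contiguity` and `corner_casoratian` this gives (`quadM3_bCorner'`)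
`M₃(n;1,0⁶) = U'W'' − U''W' = (−1)^n · 4 n⁴ (3n)! / (3 (n!)¹⁵)` for `n ≥ 1`, and hence the `Q`-part of `wedgeDictionary` at every
edge point `aEdge m = (m, 0, m+1, 0, m+1, m+1, m+1, m+1)` for the partners `j ∈ [2,7]` (`wedgeDictionary_Q_edge`), using the closed forms
`Q(aEdge m) = (−1)^m (m+1)` and `ρ(aEdge m) = −(m!)⁴((m+1)!)¹¹/(4(3m+2)!)` PROVED here.
-/

noncomputable section

open Finset Polynomial

namespace Summit.KontsevichZagierPeriods.Zeta5Search.WedgeDictionary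

open Summit.KontsevichZagierPeriods.Zeta5Search.DualSeries
open Literature.NumberTheory.Transcendental
open Literature.NumberTheory.Transcendental.BallRivoal (pfEval pf_unique poch_pos)
open Literature.NumberTheory.Irrationality.CressonFischlerRivoal2008 (exists_pf_data)
open Literature.NumberTheory.Irrationality.BrownZudilin2022 (bOfA QOf Qcoeff zchoose pOf qOf Converges)

/-! ### The edge's partner `b'' = (n; 1, 1, 0⁵)` and its summand -/

/-- The partner of the edge: `b'' = b' + e₂ = (n; 1, 1, 0⁵)`. -/
def bEdge2 (n : ℕ) : ℕ → ℤ := Function.update (bCorner' n) 2 (bCorner' n 2 + 1)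

/-- Values of `b''`. -/
theorem bEdge2_apply (n j : ℕ) : bEdge2 n j = if j = 0 then (n : ℤ) else if j = 1 ∨ j = 2 then 1 else 0 := by
  unfold bEdge2 bCorner'
  rcases Nat.lt_or_ge j 3 with h | h
  · interval_cases j <;> simp [bCorner]
  · rw [Function.update_of_ne (by omega), Function.update_of_ne (by omega)]
    simp [bCorner, show j ≠ 0 by omega, show ¬(j = 1 ∨ j = 2) by omega]

/-- `(b'')₀ = n` as a natural number. -/
theorem bEdge2_zero_toNat (n : ℕ) : (bEdge2 n 0).toNat = n := by rw [bEdge2_apply]; simp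

/-- For `n ≥ 1` the partner lies in the box with the parameter-sum bound. -/
theorem box_bEdge2 (n : ℕ) (hn : 1 ≤ n) : InBox (bEdge2 n) ∧ ∑ j ∈ range 7, bEdge2 n (j + 1) ≤ 3 * bEdge2 n 0 + 1 := by
  refine ⟨⟨by rw [bEdge2_apply]; simp, fun j hj => ?_⟩, ?_⟩
  · rw [bEdge2_apply, bEdge2_apply]
    have : j + 1 ≠ 0 := by omega
    simp only [this, if_false, if_true]
    split_ifs <;> constructor <;> push_cast <;> omega
  · simp only [sum_range_succ, sum_range_zero, bEdge2_apply]
    norm_num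
    omega

/-- `numPoly_{b''}(t+1) = (2t+n+2)(t+1)²(t+n+1)²`. -/
theorem eval_numPoly_bEdge2 (n : ℕ) (t : ℚ) :
    ((numPoly (bEdge2 n)).comp (X + C 1)).eval t = (2 * t + n + 2) * (((t + 1) * (t + n + 1)) ^ 2) := by
  rw [eval_comp, eval_add, eval_X, eval_C, eval_numPoly, bEdge2_apply]
  simp only [if_true]
  have h1 : ∀ j ∈ range 7, (BallRivoal.poch (t + 1) (bEdge2 n (j + 1)).toNat *
      BallRivoal.poch (t + 1 + (((n : ℤ) - bEdge2 n (j + 1) + 1 : ℤ) : ℚ)) (bEdge2 n (j + 1)).toNat) =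
      if j < 2 then (t + 1) * (t + n + 1) else 1 := by
    intro j hj
    rw [bEdge2_apply]
    have hj0 : j + 1 ≠ 0 := by omega
    by_cases hj2 : j < 2
    · have hor : (j + 1 = 1 ∨ j + 1 = 2) := by omega
      rw [if_neg hj0, if_pos hor, if_pos hj2, show (1 : ℤ).toNat = 1 from rfl]
      simp only [BallRivoal.poch, prod_range_one, Nat.cast_zero, add_zero]
      push_cast; ring
    · have hor : ¬(j + 1 = 1 ∨ j + 1 = 2) := by omega
      rw [if_neg hj0, if_neg hor, if_neg hj2, show (0 : ℤ).toNat = 0 from rfl]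
      simp only [BallRivoal.poch, prod_range_zero, mul_one]
  rw [prod_congr rfl h1]
  simp only [prod_range_succ, prod_range_zero]
  norm_num
  ring

/-- Canonical data of `b''` and their evaluation. -/
theorem pfEval_edge2 (n : ℕ) (hn : 1 ≤ n) (t : ℚ) (ht : ∀ p, p ≤ n → t + p + 1 ≠ 0) :
    IsPFData (bEdge2 n) (pfData (bEdge2 n)) ∧
      pfEval n 6 (pfData (bEdge2 n)) t =
        (2 * t + n + 2) * (((t + 1) * (t + n + 1)) ^ 2) / BallRivoal.poch (t + 1) (n + 1) ^ 6 := by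
  have hex := exists_isPFData (bEdge2 n) (box_bEdge2 n hn).1 (box_bEdge2 n hn).2
  have hc : IsPFData (bEdge2 n) (pfData (bEdge2 n)) := isPFData_pfData (Classical.choose_spec hex)
  refine ⟨hc, ?_⟩
  have h := hc t (by rw [bEdge2_zero_toNat]; exact ht)
  rw [bEdge2_zero_toNat, eval_numPoly_bEdge2] at h
  exact h

/-! ### The edge certificate -/

/-- `A'(n) = n²(61n³+81n²+42n+8)`. -/
def edgeA (n : ℚ) : ℚ := n ^ 2 * (61 * n ^ 3 + 81 * n ^ 2 + 42 * n + 8)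
/-- `B'(n) = 2n²(n+1)⁹`. -/
def edgeB (n : ℚ) : ℚ := 2 * n ^ 2 * (n + 1) ^ 9

/-- Certificate numerator `ỹ_n(t)` (degree 6 in `t`). -/
def yEdge (n t : ℚ) : ℚ :=
  7 * (n + 1) ^ 4 * (9 * n ^ 3 - 7 * n ^ 2 - 5 * n - 1) + 6 * (n + 1) ^ 3 * (19 * n ^ 3 - 49 * n ^ 2 - 35 * n - 7) * t
    - 15 * (n + 1) ^ 2 * (3 * n ^ 3 + 49 * n ^ 2 + 35 * n + 7) * t ^ 2 - 140 * (n + 1) * (2 * n + 1) * (n ^ 2 + 3 * n + 1) * t ^ 3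
    - 7 * (41 * n ^ 3 + 105 * n ^ 2 + 75 * n + 15) * t ^ 4 - 42 * (3 * n + 1) * (n + 1) * t ^ 5 - 7 * (3 * n + 1) * t ^ 6

/-- `ỹ_n` as a polynomial. -/
def yEdgePoly (n : ℚ) : ℚ[X] :=
  C (7 * (n + 1) ^ 4 * (9 * n ^ 3 - 7 * n ^ 2 - 5 * n - 1)) + C (6 * (n + 1) ^ 3 * (19 * n ^ 3 - 49 * n ^ 2 - 35 * n - 7)) * X
    + C (-(15 * (n + 1) ^ 2 * (3 * n ^ 3 + 49 * n ^ 2 + 35 * n + 7))) * X ^ 2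
    + C (-(140 * (n + 1) * (2 * n + 1) * (n ^ 2 + 3 * n + 1))) * X ^ 3
    + C (-(7 * (41 * n ^ 3 + 105 * n ^ 2 + 75 * n + 15))) * X ^ 4 + C (-(42 * (3 * n + 1) * (n + 1))) * X ^ 5
    + C (-(7 * (3 * n + 1))) * X ^ 6

/-- `eval` of `yEdgePoly`. -/
theorem eval_yEdgePoly (n t : ℚ) : (yEdgePoly n).eval t = yEdge n t := by
  simp only [yEdgePoly, yEdge, eval_add, eval_mul, eval_C, eval_X, eval_pow]; ring

/-- `deg ỹ_n ≤ 6`. -/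
theorem natDegree_yEdgePoly_le (n : ℚ) : (yEdgePoly n).natDegree ≤ 6 := by
  unfold yEdgePoly; compute_degree

/-- **The Gosper identity of the edge.** -/
theorem gosper_edge (n t : ℚ) :
    (21 * n * (3 * n + 1) * ((t + 1) * (t + n + 1)) ^ 2 - n * edgeA n) * (2 * t + n + 2) * (t + n + 2) ^ 6
        - n * edgeB n * (2 * t + n + 3) = (t + 1) ^ 6 * yEdge n (t + 1) - (t + n + 2) ^ 6 * yEdge n t := by
  unfold edgeA edgeB yEdge; ring

/-- Partial fractions of `H = ỹ_n/((t+1)_{n+1})⁶` exist for `n ≥ 1` (degree `6 < 6(n+1)`). -/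
theorem exists_pf_yEdge (n : ℕ) (hn : 1 ≤ n) : ∃ d : ℕ → ℕ → ℚ, ∀ t : ℚ, (∀ p, p ≤ n → t + p + 1 ≠ 0) →
    pfEval n 6 d t = yEdge n t / BallRivoal.poch (t + 1) (n + 1) ^ 6 := by
  have hdeg : (yEdgePoly n).degree < ((6 * (n + 1) : ℕ) : WithBot ℕ) :=
    (degree_le_of_natDegree_le (natDegree_yEdgePoly_le n)).trans_lt (by exact_mod_cast (by omega))
  obtain ⟨d, hd⟩ := exists_pf_data n 6 (by norm_num) (yEdgePoly n) hdeg
  exact ⟨d, fun t ht => by rw [hd t ht, eval_yEdgePoly]⟩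

/-- The edge identity for the summands at natural arguments:
`21n(3n+1)R''_n(t) − nA'R_n(t) − nB'R_{n+1}(t) + H(t) − H(t+1) = 0`. -/
theorem edge_identity (n t : ℕ) :
    21 * (n : ℚ) * (3 * n + 1) * ((2 * (t : ℚ) + n + 2) * ((((t : ℚ) + 1) * ((t : ℚ) + n + 1)) ^ 2)
        / BallRivoal.poch ((t : ℚ) + 1) (n + 1) ^ 6)
      - (n : ℚ) * edgeA n * ((2 * (t : ℚ) + n + 2) / BallRivoal.poch ((t : ℚ) + 1) (n + 1) ^ 6)
      - (n : ℚ) * edgeB n * ((2 * (t : ℚ) + (((n + 1 : ℕ)) : ℚ) + 2) / BallRivoal.poch ((t : ℚ) + 1) (n + 1 + 1) ^ 6)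
      + yEdge n t / BallRivoal.poch ((t : ℚ) + 1) (n + 1) ^ 6
      - yEdge n ((t : ℚ) + 1) / BallRivoal.poch ((t : ℚ) + 1 + 1) (n + 1) ^ 6 = 0 := by
  set P := BallRivoal.poch ((t : ℚ) + 1) (n + 1) with hP
  have hPpos : 0 < P := poch_pos (by positivity) _
  have e2 : BallRivoal.poch ((t : ℚ) + 1) (n + 1 + 1) = P * ((t : ℚ) + n + 2) := by
    rw [poch_succ_right]; push_cast; ring
  have e4 : BallRivoal.poch ((t : ℚ) + 1 + 1) (n + 1) * ((t : ℚ) + 1) = P * ((t : ℚ) + n + 2) := by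
    rw [← e2, poch_succ_left ((t : ℚ) + 1) (n + 1)]; ring
  have h1 : ((t : ℚ) + 1) ≠ 0 := by positivity
  have h2 : ((t : ℚ) + n + 2) ≠ 0 := by positivity
  have e4' : BallRivoal.poch ((t : ℚ) + 1 + 1) (n + 1) = P * ((t : ℚ) + n + 2) / ((t : ℚ) + 1) := by
    rw [← e4, mul_div_cancel_right₀ _ h1]
  rw [e2, e4']
  push_cast
  have hid := gosper_edge (n : ℚ) (t : ℚ)
  field_simp
  linear_combination hid

/-- **Contiguity of the edge**: `21n(3n+1)·U''_n = n·A'(n)·U_n + n·B'(n)·U_{n+1}` and the same for `W` (`n ≥ 1`). -/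
theorem edge_contiguity (n : ℕ) (hn : 1 ≤ n) :
    21 * (n : ℚ) * (3 * n + 1) * coeffU (bEdge2 n)
        = (n : ℚ) * edgeA n * coeffU (bCorner n) + (n : ℚ) * edgeB n * coeffU (bCorner (n + 1)) ∧
    21 * (n : ℚ) * (3 * n + 1) * coeffW (bEdge2 n)
        = (n : ℚ) * edgeA n * coeffW (bCorner n) + (n : ℚ) * edgeB n * coeffW (bCorner (n + 1)) := by
  obtain ⟨d, hd⟩ := exists_pf_yEdge n hn
  set c' := pfData (bEdge2 n)
  set c0 := pfData (bCorner n)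
  set c1 := pfData (bCorner (n + 1))
  set e : ℕ → ℕ → ℚ := fun o p => 21 * (n : ℚ) * (3 * n + 1) * padData n c' o p
    + (-((n : ℚ) * edgeA n)) * padData n c0 o p + (-((n : ℚ) * edgeB n)) * c1 o p
    + padData n d o p - shiftUp d o p with he_def
  have he : ∀ t : ℕ, pfEval (n + 1) 6 e t = 0 := by
    intro t
    have ht : ∀ m p : ℕ, p ≤ m → (t : ℚ) + p + 1 ≠ 0 := fun m p _ => by positivity
    have ht1 : ∀ m p : ℕ, p ≤ m → (t : ℚ) + 1 + p + 1 ≠ 0 := fun m p _ => by positivity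
    rw [he_def, pfEval_comb, pfEval_padData (by omega), pfEval_padData (by omega), pfEval_padData (by omega),
      pfEval_shiftUp, (pfEval_edge2 n hn _ (ht n)).2, pfEval_corner n _ (ht n), pfEval_corner (n + 1) _ (ht _),
      hd _ (ht _), hd _ (ht1 _)]
    have := edge_identity n t
    push_cast at this ⊢
    linear_combination this
  have hsum : ∀ {o : ℕ}, o < 6 →
      21 * (n : ℚ) * (3 * n + 1) * ∑ p ∈ range (n + 1), c' o p
        + (-((n : ℚ) * edgeA n)) * ∑ p ∈ range (n + 1), c0 o p
        + (-((n : ℚ) * edgeB n)) * ∑ p ∈ range (n + 2), c1 o p = 0 := by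
    intro o ho
    have hz := sum_eq_zero_of_pfEval_zero (n + 1) 6 e he ho
    simp only [he_def, sum_add_distrib, sum_sub_distrib, ← mul_sum] at hz
    rw [sum_padData (by omega), sum_padData (by omega), sum_padData (by omega), sum_shiftUp] at hz
    linear_combination hz
  have hc' := (pfEval_edge2 n hn 0 (fun p _ => by positivity)).1
  have hU' : coeffU (bEdge2 n) = ∑ p ∈ range (n + 1), c' 4 p := by rw [coeffU_eq hc', bEdge2_zero_toNat]
  have hW' : coeffW (bEdge2 n) = ∑ p ∈ range (n + 1), c' 2 p := by rw [coeffW_eq hc', bEdge2_zero_toNat]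
  have hU : ∀ m, coeffU (bCorner m) = ∑ p ∈ range (m + 1), pfData (bCorner m) 4 p := fun m => by
    rw [coeffU_eq (isPFData_corner m), bCorner_zero_toNat]
  have hW : ∀ m, coeffW (bCorner m) = ∑ p ∈ range (m + 1), pfData (bCorner m) 2 p := fun m => by
    rw [coeffW_eq (isPFData_corner m), bCorner_zero_toNat]
  refine ⟨?_, ?_⟩
  · rw [hU', hU, hU]; linear_combination hsum (show 4 < 6 by norm_num)
  · rw [hW', hW, hW]; linear_combination hsum (show 2 < 6 by norm_num)

/-! ### The edge identity -/

/-- `d(b') = 3n − 1`. -/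
theorem dOf_bCorner' (n : ℕ) : dOf (bCorner' n) = 3 * n - 1 := by
  have h1 : bCorner' n 1 = 1 := by simp [bCorner', bCorner]
  have h0 : ∀ j, 2 ≤ j → bCorner' n j = 0 := fun j hj => by
    rw [bCorner', Function.update_of_ne (by omega)]; simp [bCorner, show j ≠ 0 by omega]
  simp only [dOf, sum_range_succ, sum_range_zero, bCorner'_zero, h1, h0 2 le_rfl, h0 3 (by norm_num), h0 4 (by norm_num),
    h0 5 (by norm_num), h0 6 (by norm_num), h0 7 (by norm_num)]
  ring

/-- **`M₃(n;1,0⁶) = (−1)^n·4n⁴(3n)!/(3(n!)¹⁵)`** for `n ≥ 1`. -/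
theorem quadM3_bCorner' (n : ℕ) (hn : 1 ≤ n) :
    quadM3 (bCorner' n) = (-1) ^ n * 4 * (n : ℚ) ^ 4 * ((3 * n).factorial : ℚ) / (3 * ((n.factorial : ℚ)) ^ 15) := by
  have hminor := wedgeQ_eq_quadM3 (bCorner' n) (box_bCorner' n).1 (by rw [dOf_bCorner']; omega)
    (show 1 ∈ range 7 by simp) (by rw [bCorner'_zero]; simp [bCorner', bCorner])
  rw [← hminor, show Function.update (bCorner' n) (1 + 1) (bCorner' n (1 + 1) + 1) = bEdge2 n from rfl]
  obtain ⟨hU', hW'⟩ := corner_contiguity n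
  obtain ⟨hU'', hW''⟩ := edge_contiguity n hn
  have hcas := corner_casoratian n
  unfold cornerCas at hcas
  have hn' : (n : ℚ) ≠ 0 := by exact_mod_cast (show n ≠ 0 by omega)
  have h3 : (3 * (n : ℚ) + 1) ≠ 0 := by positivity
  have hf : (n.factorial : ℚ) ≠ 0 := by positivity
  have hf1 : ((n + 1).factorial : ℚ) ≠ 0 := by positivity
  have f1 : ((3 * n + 1).factorial : ℚ) = (3 * (n : ℚ) + 1) * ((3 * n).factorial : ℚ) := by
    simp only [Nat.factorial_succ]; push_cast; ring
  have f3 : ((n + 1).factorial : ℚ) = ((n : ℚ) + 1) * (n.factorial : ℚ) := by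
    simp only [Nat.factorial_succ]; push_cast; ring
  rw [f1, f3] at hcas
  -- solve the four linear relations for U', W', U'', W'' and substitute
  have eU' : coeffU (bCorner' n) = (-(2 * (41 * (n : ℚ) ^ 3 + 44 * (n : ℚ) ^ 2 + 21 * n + 4)) * coeffU (bCorner n)
      - 2 * ((n : ℚ) + 1) ^ 9 * coeffU (bCorner (n + 1))) / (28 * (3 * (n : ℚ) + 1)) := by
    rw [eq_div_iff (by positivity)]; linear_combination hU'
  have eW' : coeffW (bCorner' n) = (-(2 * (41 * (n : ℚ) ^ 3 + 44 * (n : ℚ) ^ 2 + 21 * n + 4)) * coeffW (bCorner n)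
      - 2 * ((n : ℚ) + 1) ^ 9 * coeffW (bCorner (n + 1))) / (28 * (3 * (n : ℚ) + 1)) := by
    rw [eq_div_iff (by positivity)]; linear_combination hW'
  have eU'' : coeffU (bEdge2 n) = ((n : ℚ) * edgeA n * coeffU (bCorner n) + (n : ℚ) * edgeB n * coeffU (bCorner (n + 1)))
      / (21 * (n : ℚ) * (3 * n + 1)) := by
    rw [eq_div_iff (by positivity)]; linear_combination hU''
  have eW'' : coeffW (bEdge2 n) = ((n : ℚ) * edgeA n * coeffW (bCorner n) + (n : ℚ) * edgeB n * coeffW (bCorner (n + 1)))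
      / (21 * (n : ℚ) * (3 * n + 1)) := by
    rw [eq_div_iff (by positivity)]; linear_combination hW''
  have key : coeffU (bCorner' n) * coeffW (bEdge2 n) - coeffU (bEdge2 n) * coeffW (bCorner' n)
      = -(n : ℚ) ^ 4 * ((n : ℚ) + 1) ^ 9 / (42 * (3 * (n : ℚ) + 1))
        * (coeffU (bCorner n) * coeffW (bCorner (n + 1)) - coeffU (bCorner (n + 1)) * coeffW (bCorner n)) := by
    rw [eU', eW', eU'', eW'']; unfold edgeA edgeB; field_simp; ring
  rw [key, hcas]
  field_simp
  ring

/-! ### The cellular side of the edge: `aEdge m = (m, 0, m+1, 0, m+1, m+1, m+1, m+1)` -/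

/-- The cellular parameters of the edge point with `b = (m+1; 1, 0⁶)`. -/
def aEdge (m : ℕ) : Fin 8 → ℤ := ![(m : ℤ), 0, m + 1, 0, m + 1, m + 1, m + 1, m + 1]

/-- `b(aEdge m) = (m+1; 1, 0⁶) = bCorner' (m+1)`. -/
theorem bOfA_aEdge (m : ℕ) : bOfA (aEdge m) = bCorner' (m + 1) := by
  funext j
  have h0 : ∀ j, 2 ≤ j → bCorner' (m + 1) j = 0 := fun j hj => by
    rw [bCorner', Function.update_of_ne (by omega)]; simp [bCorner, show j ≠ 0 by omega]
  match j with
  | 0 => rw [bCorner'_zero]; simp [bOfA, aEdge]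
  | 1 => simp [bOfA, aEdge, bCorner', bCorner]
  | 2 => rw [h0 2 le_rfl]; simp [bOfA, aEdge]
  | 3 => rw [h0 3 (by norm_num)]; simp [bOfA, aEdge]
  | 4 => rw [h0 4 (by norm_num)]; simp [bOfA, aEdge]
  | 5 => rw [h0 5 (by norm_num)]; simp [bOfA, aEdge]
  | 6 => rw [h0 6 (by norm_num)]; simp [bOfA, aEdge]
  | 7 => rw [h0 7 (by norm_num)]; simp [bOfA, aEdge]
  | k + 8 => rw [h0 (k + 8) (by omega)]; simp [bOfA]

/-- `p(aEdge m) = (m+1, m+1, m+1, m+1, m+1, m+1, m)`. -/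
theorem pOf_aEdge (m : ℕ) : pOf (aEdge m) = ![(m : ℤ) + 1, m + 1, m + 1, m + 1, m + 1, m + 1, m] := by
  funext i; fin_cases i <;> simp [pOf, aEdge]

/-- `q(aEdge m) = (0, m+1, m, m, 0)`. -/
theorem qOf_aEdge (m : ℕ) : qOf (aEdge m) = ![0, (m : ℤ) + 1, m, m, 0] := by
  funext i; fin_cases i <;> simp [qOf, aEdge]

/-- **`Q(aEdge m) = (−1)^m (m+1)`**: the double sum (17) has the single non-zero term `k₁ = k₂ = m+1`. -/
theorem QOf_aEdge (m : ℕ) : QOf (aEdge m) = (-1) ^ m * (m + 1) := by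
  unfold QOf Qcoeff
  rw [pOf_aEdge, qOf_aEdge]
  simp only [Matrix.cons_val_zero, Matrix.cons_val_one, Matrix.cons_val, Fin.sum_univ_seven, add_zero]
  rw [Finset.Icc_self, sum_singleton]
  rw [Finset.sum_eq_single_of_mem ((m : ℤ) + 1) (by simp)]
  · have h1 : zchoose ((m : ℤ) + 1) (m + 1) = 1 := by
      simp only [zchoose]; rw [if_pos (by constructor <;> omega)]
      rw [show ((m : ℤ) + 1).toNat = m + 1 by omega]; simp
    have h2 : zchoose ((m : ℤ) + 1) m = (m : ℤ) + 1 := by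
      simp only [zchoose]; rw [if_pos (by constructor <;> omega)]
      rw [show ((m : ℤ) + 1).toNat = m + 1 by omega, Int.toNat_natCast, Nat.choose_succ_self_right]; push_cast; ring
    have h3 : zchoose ((m : ℤ) + 1) 0 = 1 := by
      simp only [zchoose]; rw [if_pos (by constructor <;> omega)]; simp
    have h4 : zchoose 0 0 = 1 := by simp [zchoose]
    have h5 : zchoose (m : ℤ) 0 = 1 := by simp [zchoose]
    simp only [sub_self, h1, h3, h4, h5, show (m : ℤ) + 1 + (m + 1) + m - (m + 1) - m = m + 1 by ring,
      show (m : ℤ) + 1 + m - (m + 1) - m = 0 by ring, h2, mul_one, one_mul]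
    have h7 : ((m : ℤ) + 1 + (m + 1) + (m + 1) + (m + 1) + (m + 1) + (m + 1) + m).toNat = 7 * m + 6 := by
      rw [show (m : ℤ) + 1 + (m + 1) + (m + 1) + (m + 1) + (m + 1) + (m + 1) + m = ((7 * m + 6 : ℕ) : ℤ) by push_cast; ring,
        Int.toNat_natCast]
    rw [h7, show 7 * m + 6 = 2 * (3 * m + 3) + m by ring, pow_add, pow_mul]
    norm_num
  · intro k _ hk
    have hz : zchoose 0 (k - ((m : ℤ) + 1)) = 0 := by
      simp only [zchoose]; rw [if_neg]; omega
    simp [hz]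

/-- **`ρ(aEdge m) = −(m!)⁴((m+1)!)¹¹/(4(3m+2)!)`**. -/
theorem rhoOf_aEdge (m : ℕ) :
    rhoOf (aEdge m) = -(((m.factorial : ℚ)) ^ 4 * (((m + 1).factorial : ℚ)) ^ 11) / (4 * ((3 * m + 2).factorial : ℚ)) := by
  unfold rhoOf
  rw [bOfA_aEdge]
  have hd : dOf (bCorner' (m + 1)) = ((3 * m + 2 : ℕ) : ℤ) := by rw [dOf_bCorner']; push_cast; omega
  have h0 : bCorner' (m + 1) 0 = ((m + 1 : ℕ) : ℤ) := by rw [bCorner'_zero]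
  have h1 : bCorner' (m + 1) 1 = 1 := by simp [bCorner', bCorner]
  have hz : ∀ j, 2 ≤ j → bCorner' (m + 1) j = 0 := fun j hj => by
    rw [bCorner', Function.update_of_ne (by omega)]; simp [bCorner, show j ≠ 0 by omega]
  dsimp only
  rw [hd, Int.toNat_natCast]
  simp only [Epairs, List.map, sum_range_succ, sum_range_zero, h0, h1, hz 2 le_rfl, hz 3 (by norm_num), hz 4 (by norm_num),
    hz 5 (by norm_num), hz 6 (by norm_num), hz 7 (by norm_num), List.prod_cons, List.prod_nil]
  norm_num
  ring

/-- **The `Q`-part of `wedgeDictionary` on the edge**: for every `m` and every partner `j ∈ [2,7]`,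
`Q(a) = ρ(a)·(U(b)W(b+e_j) − U(b+e_j)W(b))` at `a = aEdge m` (`b = (m+1;1,0⁶)`). -/
theorem wedgeDictionary_Q_edge (m : ℕ) {j : ℕ} (hj : j ∈ Icc 2 7) :
    (QOf (aEdge m) : ℚ) = rhoOf (aEdge m) *
      (coeffU (bOfA (aEdge m)) * coeffW (Function.update (bOfA (aEdge m)) j (bOfA (aEdge m) j + 1)) -
        coeffU (Function.update (bOfA (aEdge m)) j (bOfA (aEdge m) j + 1)) * coeffW (bOfA (aEdge m))) := by
  have hj' : j ∈ Icc 1 7 := by simp only [mem_Icc] at hj ⊢; omega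
  have hz : ∀ i, 2 ≤ i → bCorner' (m + 1) i = 0 := fun i hi => by
    rw [bCorner', Function.update_of_ne (by omega)]; simp [bCorner, show i ≠ 0 by omega]
  have h1 : bCorner' (m + 1) 1 = 1 := by simp [bCorner', bCorner]
  have hreg : ∀ i ∈ Icc 1 7, 0 ≤ bOfA (aEdge m) i ∧ 2 * bOfA (aEdge m) i ≤ bOfA (aEdge m) 0 + 1 := by
    intro i hi
    rw [bOfA_aEdge, bCorner'_zero]
    obtain ⟨hi1, hi7⟩ := mem_Icc.1 hi
    rcases Nat.lt_or_ge i 2 with h | h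
    · have : i = 1 := by omega
      subst this; rw [h1]; exact ⟨by norm_num, by push_cast; omega⟩
    · rw [hz i h]; exact ⟨le_rfl, by push_cast; omega⟩
  have hd : 0 ≤ dOf (bOfA (aEdge m)) := by rw [bOfA_aEdge, dOf_bCorner']; omega
  have hpart : 2 * (bOfA (aEdge m) j + 1) ≤ bOfA (aEdge m) 0 + 1 := by
    rw [bOfA_aEdge, bCorner'_zero, hz j (mem_Icc.1 hj).1]; push_cast; omega
  refine (Q_part_iff_quadM3 (aEdge m) hj' hreg hd hpart).2 ?_
  rw [bOfA_aEdge, quadM3_bCorner' (m + 1) (by omega), QOf_aEdge, rhoOf_aEdge]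
  have hf : (m.factorial : ℚ) ≠ 0 := by positivity
  have hf1 : ((m + 1).factorial : ℚ) ≠ 0 := by positivity
  have hf3 : ((3 * m + 2).factorial : ℚ) ≠ 0 := by positivity
  have f1 : ((3 * (m + 1)).factorial : ℚ) = (3 * (m : ℚ) + 3) * ((3 * m + 2).factorial : ℚ) := by
    rw [show 3 * (m + 1) = (3 * m + 2) + 1 by ring]; simp only [Nat.factorial_succ]; push_cast; ring
  have f3 : ((m + 1).factorial : ℚ) = ((m : ℚ) + 1) * (m.factorial : ℚ) := by
    simp only [Nat.factorial_succ]; push_cast; ring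
  rw [f1, f3]
  push_cast
  field_simp
  ring

end Summit.KontsevichZagierPeriods.Zeta5Search.WedgeDictionary
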